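import Mathlib
import Summits.ValiantsHypothesis.ValiantsHypothesis.Theorems.BarrierLeverPartitionMinorsHitByVPHiddenStatesFullJoinShell2

/-!
# Route BarrierLever — item `PartitionMinorsHitByVP` (stmt-ValiantsHypothesis-19717), line `hidden_states`:
# CONJECTURE FJ FOR ALL PAIRS OF LEAF-PEELABLE TOP FAMILIES — `(B_s(C) ∪ 𝒳, B_s(C) ∪ 𝒴)`

Helper file (`--supports stmt-ValiantsHypothesis-19717`; cell valiant-natproofs, rung V4, 𝒟-side door (c), line
`Cruxes/PartitionMinorsHitByVP/Lines/hidden_states.lean` v8; prover seat val-np-p3 gen 16). Definition-free. Closes NO item.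

THE POINT (memo val-np-p3 g16 «full join» §13–§14). The closure of the equal-link method: let `𝒳`, `𝒴` be families of `m` subsets of `C` of
size `s + 1` which are LEAF-PEELABLE — every nonempty subfamily has a member with an element private to it (for `s = 1`: forests; in general:
hypergraphs without a 2-core; any two distinct sets qualify, so this contains p677375 and p677930). Then the lower pair
`(B_s(C) ∪ 𝒳, B_s(C) ∪ 𝒴)` (any injective enumerations) satisfies FJ with `h + s + m` states (`fullJoinCube_peelableTops`): peel a top `X` at a
private element `a` on the row side and `Y` at a private `b` on the column side — both have top-degree one, so the equal-link step (p676301)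
applies; the deletion pair is `(B_s(C∖a) ∪ (𝒳∖X), B_s(C∖b) ∪ (𝒴∖Y))`, again leaf-peelable after the transposition `(a b)` (induction on `m`),
and the link pair is a first-shell pair (p677375). Door corollary `partitionMinor_hit_peelableTops` (`SmallCircuits ℂ (h+h) 8`, needs
`h + s + m ≤ h³`). The first pairs outside: a 2-core on one side (s = 1: a triangle against three edges).

WHAT THIS IS NOT: the general conjecture FJ stays open; item 19717 stays OPEN; nothing on crux 14610 or VP ≠ VNP.
-/

set_option linter.dupNamespace false

namespace Summit.ValiantsHypothesis.ValiantsHypothesis.Theorems.BarrierLever.HiddenStates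

open Finset Matrix

noncomputable section

namespace FullJoin

variable {h : ℕ}

/-! ## 1. Bookkeeping on `B_s(C) ∪ 𝒳` -/

/-- `B_s(C) ∪ 𝒳` is a lower family when every top is a subset of `C` of size `s + 1`. -/
theorem isLowerSet_tops (C : Finset (Fin h)) (𝒳 : Finset (Finset (Fin h))) (s : ℕ) (h𝒳 : ∀ X ∈ 𝒳, X ⊆ C ∧ X.card = s + 1) :
    IsLowerSet ((↑(𝒳 ∪ C.powerset.filter fun U => U.card ≤ s) : Set (Finset (Fin h)))) := by
  intro U V hVU hU
  rw [Finset.mem_coe, Finset.mem_union, mem_ballF] at hU ⊢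
  rcases hU with hUX | ⟨hUC, hUs⟩
  · by_cases hVU' : V = U
    · exact Or.inl (hVU' ▸ hUX)
    · right
      obtain ⟨hXC, hXcard⟩ := h𝒳 U hUX
      refine ⟨hVU.trans hXC, ?_⟩
      have hlt : V.card < U.card := Finset.card_lt_card (lt_of_le_of_ne hVU hVU')
      omega
  · exact Or.inr ⟨hVU.trans hUC, (Finset.card_le_card hVU).trans hUs⟩

/-- The deletion family at a private element `a` of the top `X`: `B_s(C ∖ a) ∪ (𝒳 ∖ X)`. -/
theorem deletion_tops (C : Finset (Fin h)) (𝒳 : Finset (Finset (Fin h))) (s : ℕ) (X : Finset (Fin h)) (a : Fin h)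
    (haX : a ∈ X) (hpriv : ∀ X' ∈ 𝒳, X' ≠ X → a ∉ X') :
    {U | U ∈ ((↑(𝒳 ∪ C.powerset.filter fun U => U.card ≤ s)) : Set (Finset (Fin h))) ∧ a ∉ U} =
      ↑(𝒳.erase X ∪ (C.erase a).powerset.filter fun U => U.card ≤ s) := by
  ext U
  simp only [Set.mem_setOf_eq, Finset.coe_union, Set.mem_union, Finset.mem_coe, mem_ballF, Finset.subset_erase,
    Finset.mem_erase]
  constructor
  · rintro ⟨hUX | ⟨hUC, hUs⟩, haU⟩
    · exact Or.inl ⟨fun h' => haU (h' ▸ haX), hUX⟩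
    · exact Or.inr ⟨⟨hUC, haU⟩, hUs⟩
  · rintro (⟨hUX, hU𝒳⟩ | ⟨⟨hUC, haU⟩, hUs⟩)
    · exact ⟨Or.inl hU𝒳, hpriv U hU𝒳 hUX⟩
    · exact ⟨Or.inr ⟨hUC, hUs⟩, haU⟩

/-- The link family at a private element `a` of the top `X` (`s ≥ 1`): `B_{s−1}(C ∖ a) ∪ {X ∖ a}`. -/
theorem link_tops (C : Finset (Fin h)) (𝒳 : Finset (Finset (Fin h))) (s : ℕ) (X : Finset (Fin h)) (a : Fin h)
    (hX : X ∈ 𝒳) (haX : a ∈ X) (hXC : X ⊆ C) (hpriv : ∀ X' ∈ 𝒳, X' ≠ X → a ∉ X') :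
    (fun U => U.erase a) ''
        {U | U ∈ ((↑(𝒳 ∪ C.powerset.filter fun U => U.card ≤ s + 1)) : Set (Finset (Fin h))) ∧ a ∈ U} =
      ↑(insert (X.erase a) ((C.erase a).powerset.filter fun U => U.card ≤ s)) := by
  ext V
  simp only [Set.mem_image, Set.mem_setOf_eq, Finset.coe_union, Set.mem_union, Finset.coe_insert, Set.mem_insert_iff,
    Finset.mem_coe, mem_ballF, Finset.subset_erase]
  constructor
  · rintro ⟨U, ⟨hUX | ⟨hUC, hUs⟩, haU⟩, rfl⟩
    · have hUX' : U = X := by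
        by_contra hne
        exact hpriv U hUX hne haU
      exact Or.inl (by rw [hUX'])
    · right
      refine ⟨⟨(Finset.erase_subset a U).trans hUC, Finset.notMem_erase a U⟩, ?_⟩
      have := Finset.card_erase_of_mem haU
      omega
  · rintro (rfl | ⟨⟨hVC, haV⟩, hVs⟩)
    · exact ⟨X, ⟨Or.inl hX, haX⟩, rfl⟩
    · refine ⟨insert a V, ⟨Or.inr ⟨?_, ?_⟩, Finset.mem_insert_self a V⟩, Finset.erase_insert haV⟩
      · exact Finset.insert_subset (hXC haX) hVC
      · rw [Finset.card_insert_of_notMem haV]; omega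

/-- A transposition is an involution on families of sets. -/
theorem map_mapEmbedding_swap_swap (a b : Fin h) (𝒵 : Finset (Finset (Fin h))) :
    (𝒵.map (Finset.mapEmbedding (Equiv.swap a b).toEmbedding).toEmbedding).map
        (Finset.mapEmbedding (Equiv.swap a b).toEmbedding).toEmbedding = 𝒵 := by
  rw [Finset.map_map]
  conv_rhs => rw [← Finset.map_refl (s := 𝒵)]
  congr 1
  ext Z : 1
  simp [Finset.mapEmbedding_apply, map_swap_swap]

/-- Leaf-peelability (every nonempty subfamily has a member with a private element) is preserved by relabelling with a transposition. -/
theorem peelable_map_swap (a b : Fin h) (𝒴 : Finset (Finset (Fin h)))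
    (hP : ∀ 𝒴' ⊆ 𝒴, 𝒴'.Nonempty → ∃ Y ∈ 𝒴', ∃ e ∈ Y, ∀ Y' ∈ 𝒴', Y' ≠ Y → e ∉ Y') :
    ∀ 𝒵' ⊆ 𝒴.map (Finset.mapEmbedding (Equiv.swap a b).toEmbedding).toEmbedding, 𝒵'.Nonempty →
      ∃ Z ∈ 𝒵', ∃ e ∈ Z, ∀ Z' ∈ 𝒵', Z' ≠ Z → e ∉ Z' := by
  classical
  intro 𝒵' h𝒵' hne
  set Φ := (Finset.mapEmbedding (Equiv.swap a b).toEmbedding).toEmbedding with hΦ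
  have hsub : 𝒵'.map Φ ⊆ 𝒴 := by
    have : 𝒵'.map Φ ⊆ (𝒴.map Φ).map Φ := Finset.map_subset_map.mpr h𝒵'
    rwa [hΦ, map_mapEmbedding_swap_swap] at this
  obtain ⟨Y, hY, e, heY, hprivY⟩ := hP (𝒵'.map Φ) hsub (by simpa using hne)
  rw [Finset.mem_map] at hY
  obtain ⟨Z, hZ, rfl⟩ := hY
  refine ⟨Z, hZ, Equiv.swap a b e, ?_, ?_⟩
  · -- `e ∈ Φ Z = Z.map σ` gives `σ e ∈ Z`
    have : e ∈ Z.map (Equiv.swap a b).toEmbedding := heY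
    rw [Finset.mem_map] at this
    obtain ⟨x, hx, hxe⟩ := this
    rw [← hxe]
    simpa [Equiv.swap_apply_self] using hx
  · intro Z' hZ' hne' hmem
    have hZ'Y : Φ Z' ∈ 𝒵'.map Φ := Finset.mem_map_of_mem Φ hZ'
    have hneq : Φ Z' ≠ Φ Z := fun h' => hne' (Φ.injective h')
    apply hprivY (Φ Z') hZ'Y hneq
    show e ∈ Z'.map (Equiv.swap a b).toEmbedding
    rw [Finset.mem_map]
    exact ⟨Equiv.swap a b e, hmem, Equiv.swap_apply_self _ _ _⟩

/-! ## 2. The peelable-tops theorem -/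

variable {K : ℕ}

/-- **CONJECTURE FJ FOR ALL PAIRS OF LEAF-PEELABLE TOP FAMILIES.** -/
theorem fullJoinCube_peelableTops (m : ℕ) :
    ∀ (s : ℕ) (C : Finset (Fin h)) (𝒳 𝒴 : Finset (Finset (Fin h))),
      (∀ X ∈ 𝒳, X ⊆ C ∧ X.card = s + 1) → (∀ Y ∈ 𝒴, Y ⊆ C ∧ Y.card = s + 1) → 𝒳.card = m → 𝒴.card = m →
      (∀ 𝒳' ⊆ 𝒳, 𝒳'.Nonempty → ∃ X ∈ 𝒳', ∃ a ∈ X, ∀ X' ∈ 𝒳', X' ≠ X → a ∉ X') →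
      (∀ 𝒴' ⊆ 𝒴, 𝒴'.Nonempty → ∃ Y ∈ 𝒴', ∃ b ∈ Y, ∀ Y' ∈ 𝒴', Y' ≠ Y → b ∉ Y') →
      ∀ (r : ℕ) (u w : Fin r → Finset (Fin h)), Function.Injective u → Function.Injective w →
        Set.range u = ↑(𝒳 ∪ C.powerset.filter fun U => U.card ≤ s) →
        Set.range w = ↑(𝒴 ∪ C.powerset.filter fun U => U.card ≤ s) →
        ∃ (tx ty : Option (Fin (h + s + m)) → Fin h → ℂ) (lam : Fin (h + s + m) → ℂ),
          (Matrix.of fun i j : Fin r => ∑ J : Finset (Fin (h + s + m)), (∏ q ∈ J, lam q) *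
            ((∏ a ∈ u i, (tx none a + ∑ q ∈ J, tx (some q) a)) *
              ∏ c ∈ w j, (ty none c + ∑ q ∈ J, ty (some q) c))).det ≠ 0 := by
  classical
  induction m with
  | zero =>
    intro s C 𝒳 𝒴 _ _ hXm hYm _ _ r u w hu hw hru hrw
    rw [Finset.card_eq_zero] at hXm hYm
    subst hXm; subst hYm
    refine fullJoinCube_pad_le u w (by omega : h ≤ h + s + 0) ?_
    exact fullJoinCube_of_range_eq u u u w hu hw rfl (by rw [hrw, hru]) (fullJoinCube_diagK u hu)
  | succ m ih =>
    intro s C 𝒳 𝒴 h𝒳 h𝒴 hXm hYm hPX hPY r u w hu hw hru hrw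
    -- peel a top with a private element on each side
    obtain ⟨X, hX, a, haX, hprivX⟩ := hPX 𝒳 (subset_refl _) (Finset.card_pos.mp (by omega))
    obtain ⟨Y, hY, b, hbY, hprivY⟩ := hPY 𝒴 (subset_refl _) (Finset.card_pos.mp (by omega))
    have hXC : X ⊆ C := (h𝒳 X hX).1
    have hYC : Y ⊆ C := (h𝒴 Y hY).1
    have hXcard : X.card = s + 1 := (h𝒳 X hX).2
    have hYcard : Y.card = s + 1 := (h𝒴 Y hY).2
    have haC : a ∈ C := hXC haX
    have hbC : b ∈ C := hYC hbY
    -- the case `s = 0`: a star leaf (`r ≤ m + 2`)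
    rcases Nat.eq_zero_or_pos s with hs0 | hspos
    · subst hs0
      have hr : r ≤ h + 0 + (m + 1) + 1 := by
        have hball : (C.powerset.filter fun U => U.card ≤ 0) ⊆ {∅} := by
          intro U hU
          rw [mem_ballF] at hU
          rw [Finset.mem_singleton]
          exact Finset.card_eq_zero.mp (Nat.le_zero.mp hU.2)
        have hF : (𝒳 ∪ C.powerset.filter fun U => U.card ≤ 0).card ≤ m + 1 + 1 := by
          calc (𝒳 ∪ C.powerset.filter fun U => U.card ≤ 0).card
              ≤ 𝒳.card + (C.powerset.filter fun U => U.card ≤ 0).card := Finset.card_union_le _ _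
            _ ≤ (m + 1) + ({∅} : Finset (Finset (Fin h))).card := by rw [hXm]; gcongr
            _ = m + 1 + 1 := by simp
        have hru' : ∀ i ∈ (Finset.univ : Finset (Fin r)), u i ∈ (𝒳 ∪ C.powerset.filter fun U => U.card ≤ 0) := by
          intro i _
          have := Set.mem_range_self (f := u) i
          rw [hru] at this
          exact this
        have := Finset.card_le_card_of_injOn u hru' (hu.injOn)
        rw [Finset.card_univ, Fintype.card_fin] at this
        omega
      exact fullJoinCube_of_le u w hu hw hr
    -- the case `s = s' + 1`
    obtain ⟨s', rfl⟩ : ∃ s', s = s' + 1 := ⟨s - 1, by omega⟩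
    set σ : Equiv.Perm (Fin h) := Equiv.swap a b with hσ
    set Φ := (Finset.mapEmbedding σ.toEmbedding).toEmbedding with hΦ
    -- families
    set BallA : Finset (Finset (Fin h)) := (C.erase a).powerset.filter fun U => U.card ≤ s' + 1 with hBallA
    set FDa : Finset (Finset (Fin h)) := 𝒳.erase X ∪ BallA with hFDa
    set FDa' : Finset (Finset (Fin h)) := (𝒴.erase Y).map Φ ∪ BallA with hFDa'
    set FDb : Finset (Finset (Fin h)) := 𝒴.erase Y ∪ (C.erase b).powerset.filter fun U => U.card ≤ s' + 1 with hFDb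
    set FLa : Finset (Finset (Fin h)) := insert (X.erase a) ((C.erase a).powerset.filter fun U => U.card ≤ s') with hFLa
    set FLa' : Finset (Finset (Fin h)) :=
      insert ((Y.erase b).map σ.toEmbedding) ((C.erase a).powerset.filter fun U => U.card ≤ s') with hFLa'
    set FLb : Finset (Finset (Fin h)) := insert (Y.erase b) ((C.erase b).powerset.filter fun U => U.card ≤ s') with hFLb
    -- relabelling by the transposition `(a b)`
    have hswap' : (C.erase a).map σ.toEmbedding = C.erase b := by
      rw [hσ, Equiv.swap_comm]; exact map_swap_erase C b a hbC haC
    have hmapD : FDa'.map Φ = FDb := by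
      rw [hFDa', hFDb, Finset.map_union, hΦ, hσ, map_mapEmbedding_swap_swap, hBallA, map_ballF, ← hσ, hswap']
    have hmapL : FLa'.map Φ = FLb := by
      rw [hFLa', hFLb, Finset.map_insert, hΦ, map_ballF, hswap']
      simp only [RelEmbedding.coe_toEmbedding, Finset.mapEmbedding_apply, hσ, map_swap_swap]
    -- the smaller top families
    have h𝒳' : ∀ X' ∈ 𝒳.erase X, X' ⊆ C.erase a ∧ X'.card = s' + 1 + 1 := by
      intro X' hX'
      rw [Finset.mem_erase] at hX'
      refine ⟨fun x hx => Finset.mem_erase.mpr ⟨fun h' => hprivX X' hX'.2 hX'.1 (h' ▸ hx), (h𝒳 X' hX'.2).1 hx⟩, (h𝒳 X' hX'.2).2⟩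
    have h𝒴' : ∀ Y'' ∈ (𝒴.erase Y).map Φ, Y'' ⊆ C.erase a ∧ Y''.card = s' + 1 + 1 := by
      intro Y'' hY''
      rw [Finset.mem_map] at hY''
      obtain ⟨Y', hY', rfl⟩ := hY''
      rw [Finset.mem_erase] at hY'
      have hY'Cb : Y' ⊆ C.erase b := fun y hy =>
        Finset.mem_erase.mpr ⟨fun h' => hprivY Y' hY'.2 hY'.1 (h' ▸ hy), (h𝒴 Y' hY'.2).1 hy⟩
      refine ⟨?_, ?_⟩
      · simpa [hΦ, Finset.mapEmbedding_apply] using map_swap_subset_erase C Y' a b haC hbC hY'Cb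
      · simp [hΦ, Finset.mapEmbedding_apply, Finset.card_map, (h𝒴 Y' hY'.2).2]
    have hXm' : (𝒳.erase X).card = m := by rw [Finset.card_erase_of_mem hX]; omega
    have hYm' : ((𝒴.erase Y).map Φ).card = m := by rw [Finset.card_map, Finset.card_erase_of_mem hY]; omega
    have hPX' : ∀ 𝒳' ⊆ 𝒳.erase X, 𝒳'.Nonempty → ∃ X ∈ 𝒳', ∃ a ∈ X, ∀ X' ∈ 𝒳', X' ≠ X → a ∉ X' :=
      fun 𝒳' h𝒳' hne => hPX 𝒳' (h𝒳'.trans (Finset.erase_subset X 𝒳)) hne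
    have hPY' := peelable_map_swap a b (𝒴.erase Y) (fun 𝒴' h𝒴' hne => hPY 𝒴' (h𝒴'.trans (Finset.erase_subset Y 𝒴)) hne)
    -- tops of the link pair
    have hX₁aC : X.erase a ⊆ C.erase a := Finset.erase_subset_erase a hXC
    have hY₁bσ : (Y.erase b).map σ.toEmbedding ⊆ C.erase a :=
      map_swap_subset_erase C (Y.erase b) a b haC hbC (Finset.erase_subset_erase b hYC)
    have hX₁acard : (X.erase a).card = s' + 1 := by rw [Finset.card_erase_of_mem haX]; omega
    have hY₁bσcard : ((Y.erase b).map σ.toEmbedding).card = s' + 1 := by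
      rw [Finset.card_map, Finset.card_erase_of_mem hbY]; omega
    -- cardinalities
    have hdisjA : Disjoint (𝒳.erase X) BallA := by
      rw [Finset.disjoint_left]
      intro X' hX' hball
      rw [hBallA, mem_ballF] at hball
      have := (h𝒳' X' hX').2
      omega
    have hdisjA' : Disjoint ((𝒴.erase Y).map Φ) BallA := by
      rw [Finset.disjoint_left]
      intro Y'' hY'' hball
      rw [hBallA, mem_ballF] at hball
      have := (h𝒴' Y'' hY'').2
      omega
    have hcardD' : FDa'.card = FDa.card := by
      rw [hFDa', hFDa, Finset.card_union_eq_card_add_card.mpr hdisjA, Finset.card_union_eq_card_add_card.mpr hdisjA', hXm', hYm']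
    have hcardD : FDb.card = FDa.card := by rw [← hmapD, Finset.card_map, hcardD']
    have hX₁a_nm : X.erase a ∉ ((C.erase a).powerset.filter fun U => U.card ≤ s') := by rw [mem_ballF]; omega
    have hY₁bσ_nm : (Y.erase b).map σ.toEmbedding ∉ ((C.erase a).powerset.filter fun U => U.card ≤ s') := by
      rw [mem_ballF]; omega
    have hcardL' : FLa'.card = FLa.card := by
      rw [hFLa', hFLa, Finset.card_insert_of_notMem hX₁a_nm, Finset.card_insert_of_notMem hY₁bσ_nm]
    have hcardL : FLb.card = FLa.card := by rw [← hmapL, Finset.card_map, hcardL']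
    -- enumerations
    obtain ⟨uD, huD, hruD⟩ := exists_enum FDa
    obtain ⟨wD, hwD, hrwD⟩ : ∃ e : Fin FDa.card → Finset (Fin h), Function.Injective e ∧ Set.range e = ↑FDb := by
      rw [← hcardD]; exact exists_enum FDb
    obtain ⟨wD', hwD', hrwD'⟩ : ∃ e : Fin FDa.card → Finset (Fin h), Function.Injective e ∧ Set.range e = ↑FDa' := by
      rw [← hcardD']; exact exists_enum FDa'
    obtain ⟨uL, huL, hruL⟩ := exists_enum FLa
    obtain ⟨wL, hwL, hrwL⟩ : ∃ e : Fin FLa.card → Finset (Fin h), Function.Injective e ∧ Set.range e = ↑FLb := by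
      rw [← hcardL]; exact exists_enum FLb
    obtain ⟨wL', hwL', hrwL'⟩ : ∃ e : Fin FLa.card → Finset (Fin h), Function.Injective e ∧ Set.range e = ↑FLa' := by
      rw [← hcardL']; exact exists_enum FLa'
    -- the step
    refine fullJoinCube_step_of_ranges u w hu hw ?_ a b uD wD uL wL huD hwD huL hwL ?_ ?_ ?_ ?_ ?_ ?_
    · rw [hru]; exact isLowerSet_tops C 𝒳 (s' + 1) h𝒳
    · rw [hruD, hru, hFDa, hBallA]; exact (deletion_tops C 𝒳 (s' + 1) X a haX hprivX).symm
    · rw [hrwD, hrw, hFDb]; exact (deletion_tops C 𝒴 (s' + 1) Y b hbY hprivY).symm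
    · rw [hruL, hru, hFLa]; exact (link_tops C 𝒳 s' X a hX haX hXC hprivX).symm
    · rw [hrwL, hrw, hFLb]; exact (link_tops C 𝒴 s' Y b hY hbY hYC hprivY).symm
    · -- deletion pair: induction hypothesis over `C ∖ a` after relabelling the columns
      have H2 := ih (s' + 1) (C.erase a) (𝒳.erase X) ((𝒴.erase Y).map Φ) h𝒳' h𝒴' hXm' hYm' hPX' hPY' FDa.card uD wD' huD hwD'
        (by rw [hruD, hFDa, hBallA]) (by rw [hrwD', hFDa', hBallA])
      have H3 := fullJoinCube_relabel_range σ uD wD' wD huD hwD (by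
        rw [hrwD, hrwD', ← coe_map_mapEmbedding, ← hΦ, hmapD]) H2
      exact H3
    · -- link pair: a first-shell pair over `C ∖ a` (radius `s'`) after relabelling the columns, then pad
      have hn : (X.erase a \ (Y.erase b).map σ.toEmbedding).card ≤ s' + 1 :=
        le_trans (Finset.card_le_card Finset.sdiff_subset) hX₁acard.le
      have H4 := fullJoinCube_firstShell (X.erase a \ (Y.erase b).map σ.toEmbedding).card s' (C.erase a) (X.erase a)
        ((Y.erase b).map σ.toEmbedding) hX₁aC hY₁bσ hX₁acard hY₁bσcard rfl FLa.card uL wL' huL hwL'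
        (by rw [hruL]) (by rw [hrwL'])
      have H5 := fullJoinCube_relabel_range σ uL wL' wL huL hwL (by
        rw [hrwL, hrwL', ← coe_map_mapEmbedding, hmapL]) H4
      exact fullJoinCube_pad_le uL wL
        (by omega : h + (X.erase a \ (Y.erase b).map σ.toEmbedding).card ≤ h + (s' + 1) + m) H5

/-- **Every leaf-peelable-tops layout is hit** (item 19717's conclusion with `b = 8` for this family): for `h ≥ 3` and `h + s + m ≤ h³`. -/
theorem partitionMinor_hit_peelableTops {r : ℕ} (hh : 3 ≤ h) (m s : ℕ) (hK : h + s + m ≤ h * h * h) (C : Finset (Fin h))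
    (𝒳 𝒴 : Finset (Finset (Fin h))) (h𝒳 : ∀ X ∈ 𝒳, X ⊆ C ∧ X.card = s + 1) (h𝒴 : ∀ Y ∈ 𝒴, Y ⊆ C ∧ Y.card = s + 1)
    (hXm : 𝒳.card = m) (hYm : 𝒴.card = m)
    (hPX : ∀ 𝒳' ⊆ 𝒳, 𝒳'.Nonempty → ∃ X ∈ 𝒳', ∃ a ∈ X, ∀ X' ∈ 𝒳', X' ≠ X → a ∉ X')
    (hPY : ∀ 𝒴' ⊆ 𝒴, 𝒴'.Nonempty → ∃ Y ∈ 𝒴', ∃ b ∈ Y, ∀ Y' ∈ 𝒴', Y' ≠ Y → b ∉ Y')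
    (u w : Fin r → Finset (Fin h)) (hu : Function.Injective u) (hw : Function.Injective w)
    (hru : Set.range u = ↑(𝒳 ∪ C.powerset.filter fun U => U.card ≤ s))
    (hrw : Set.range w = ↑(𝒴 ∪ C.powerset.filter fun U => U.card ≤ s)) :
    ∃ f ∈ Literature.Barriers.ValiantsHypothesis.SmallCircuits ℂ (h + h) 8,
      (Matrix.of fun i j : Fin r => MvPolynomial.coeff
        (∑ a ∈ u i, Finsupp.single (Fin.castAdd h a) 1 +
          ∑ c ∈ w j, Finsupp.single (Fin.natAdd h c) 1) f).det ≠ 0 :=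
  partitionMinor_hit_of_oneCube hh hK u w
    (fullJoinCube_peelableTops m s C 𝒳 𝒴 h𝒳 h𝒴 hXm hYm hPX hPY r u w hu hw hru hrw)

end FullJoin

end

end Summit.ValiantsHypothesis.ValiantsHypothesis.Theorems.BarrierLever.HiddenStates
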